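import Literature.AlgebraicGeometry.Resolution.LipmanValuativeQuadraticSequenceProofs
import Summits.ResolutionOfSingularities.ResolutionOfSingularities.Theorems.EquisingularLiftEquisingularLiftNatBlowupChartPoint
import Summits.ResolutionOfSingularities.ResolutionOfSingularities.Theorems.EquisingularLiftEquisingularLiftNatBadLocus
import HarnessLib

/-!
# [OURS · L1 W4.5(b) · EL♮] K-RIBBON-BAD: after a RIBBON touch the whole exceptional line `{g = 0}` consists of BAD points
# (`ϖ ∈ 𝔪²`) — ring form, a BAD-POINT READER for blow-up charts, and the scheme-level statement
# (crux `EquisingularLiftNat` = stmt-ResolutionOfSingularities-20038; PARENT ≥ 4 band / kill test #50, door (d♯))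

HONEST FRAMING. OURS (cell res-hironaka, crux chain w45b, slot W4.5(b)); NOT a statement of any manuscript; replaces the role of
NOTHING in the manuscript; AI-written, AI review is weaker than expert review. Helper `--supports stmt-ResolutionOfSingularities-20038
--as helper`. Object of res-L1-w45b-lead-1 gen 7 (memo `DSHARP-VOID.md`), answering res-L1-w45b-plan-1's board item «(d♯)-global»
(CHAIN v7.27 §4) and res-L1-w45b-strat-1's STRATEGY-CENSUS v12 §4 N7.3 / N7.5 (β) (door (d♯) = a type-(II) centre with REDUCED special
fibre along the non-normal ruled `v`-centre).

THE SITUATION. `X` regular over `Spec O` (`r : X → Spec O`, `ϖ ∈ O`), `s ∈ X` a point at which the germ `ϖ_s` of `ϖ` is a regular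
parameter, `π : X′ → X` the blowing up of a regular `O`-flat centre `C` whose stalk ideal at `s` is `J_s = (c₀, …, c_{k-1})`. A RIBBON
touch at `s` (multiplicity `m ≥ 2`: `𝒪_{C,s} = 𝒪_{X,s}/J_s` is a DVR in which `ϖ` has valuation `m ≥ 2`) means `ϖ_s ∈ J_s + 𝔪_s²`;
normalising the generators, ONE generator `g ∈ J_s` has `ϖ_s − g ∈ 𝔪_s²` (by hand, DSHARP-VOID §1; here it is the HYPOTHESIS `hrib`).

THE THEOREMS (all sorry-free).
* `RibbonBad.algebraMap_mem_sq` (ring form): in the affine blow-up algebra `R[J/a]`, if `a ∈ M` and `ϖ − g ∈ M²`, then `ϖ ∈ 𝔮²` for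
  EVERY ideal `𝔮 ⊇ M·R[J/a]` on the hyperplane `{g/a = 0}` (stated def-free as `g ∈ 𝔮·(a)`, which for `g ∈ J` says `g/a ∈ 𝔮`, `a` being a
  non-zero-divisor) — because `𝔮·(a) ⊆ 𝔮²` and `M² R[J/a] ⊆ 𝔮²`.
  With `M = 𝔪_s`: every prime of the chart over `𝔪_s` on the hyperplane `{g/a = 0}` of the exceptional fibre has `ϖ ∈ 𝔓²`
  (`algebraMap_localization_mem_sq`: `ϖ ∈ 𝔪²` in `R[J/a]_𝔓`).
* `RibbonBad.exists_point_varpiGerm_mem_sq_of_chart_prime` (BAD-POINT READER, the bad-locus twin of lead-1's `ChartPoint` reader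
  p550611): for `IsBlowup π J`, generators `c` of `J_s`, an index `j` and a prime `𝔓` of `𝒪_{X,s}[J_s/c_j]` over `𝔪_s` with
  `ϖ_s ∈ 𝔓²` (image under the structure map), SOME `x′ ∈ X′` over `s` is BAD: the germ of `ϖ` at `x′` (w.r.t. `π ≫ r`, the currency
  of `…NatBadLocus`) lies in `𝔪_{x′}²`. Proof: the tree's chart morphism `q : Spec B_j → X′` (`IsBlowup.exists_chart_morphism_of_index`)
  and `exists_stalk_ringHom_of_chart` (`χ ∘ chartBase = π^♯_{x′}`, `𝒪_{X′,x′} = (B_j)_𝔴`), naturality of the germ of `ϖ`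
  (`varpiGerm_comp`), and `𝔴·𝒪_{X′,x′} = 𝔪_{x′}` (`IsLocalization.AtPrime.map_eq_maximalIdeal`).
* `RibbonBad.exists_point_bad_of_ribbon` (scheme level): after a ribbon touch (`ϖ_s − g ∈ 𝔪_s²`), every chart prime `𝔓` over `𝔪_s`
  on the hyperplane `{g/c_j = 0}` (`g ∈ 𝔓·(c_j)`) yields a BAD point of `X′` over `s`; with `…NatBadLocus.not_goodAt_of_bad_below` (persistence) every point
  of every later stage over it is bad, and (DSHARP-VOID §2) every regular `O`-flat centre through such a point whose special fibre has
  a component with generic point there carries that component with multiplicity `≥ 2` — so the reduced type-(II) shape (d♯) never occurs.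

The heartbeat bump on the reader is for the elaboration of stalk/chart-ring instance unifications (26 s on the farm), not for any search.

References: tree `…AffineBlowupAlgebra` (`blowupAlgebra`; [StacksProject, Tag 052Q/07Z3]),
`…BlowupStalkCharts` (`exists_stalk_ringHom_of_chart`; [StacksProject, Tag 0804]), `…LipmanValuativeQuadraticSequenceProofs`
(`IsBlowup.exists_chart_morphism_of_index`), `…NatBlowupChartPoint` (`ChartPoint.fromSpecStalk_Spec_map_apply_eq`), `…NatBadLocus`
(`varpiGerm_comp`); [GortzWedhorn2020, (13.19)].
-/

set_option linter.dupNamespace false -- mandated namespace `Summit.<Summit>.<Problem>` of this single-conjunct summit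

noncomputable section

universe u

open CategoryTheory AlgebraicGeometry TopologicalSpace IsLocalRing
open Literature.AlgebraicGeometry.Resolution
open AlgebraicGeometry.Scheme.IdealSheafData

namespace Summit.ResolutionOfSingularities.ResolutionOfSingularities.Cruxes.EquisingularLiftNat.Sections

namespace RibbonBad

/-! ## Ring form: `ϖ ∈ 𝔮²` on the hyperplane `{g/a = 0}` of the chart `R[J/a]` -/

section Ring

variable {R : Type u} [CommRing R]

/-- **K-RIBBON-BAD, ring form.** In `R[J/a]`: if `a ∈ M` and `ϖ − g ∈ M²`, then `ϖ ∈ 𝔮²` for every ideal `𝔮 ⊇ M · R[J/a]` on the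
hyperplane `{g/a = 0}`, i.e. with `g ∈ 𝔮 · (a)` (for `g ∈ J` this says exactly that the fraction `g/a = x/a`-generator lies in `𝔮`, `a`
being a non-zero-divisor of `R[J/a]`, Stacks 07Z3 (1)) — since `𝔮 · (a) ⊆ 𝔮²` and `ϖ − g ∈ M² R[J/a] = (M R[J/a])² ⊆ 𝔮²`. OURS. [folklore] -/
theorem algebraMap_mem_sq {J M : Ideal R} {a g ϖ : R} (haM : a ∈ M) (h : ϖ - g ∈ M ^ 2)
    (𝔮 : Ideal (blowupAlgebra J a)) (hM : M.map (algebraMap R (blowupAlgebra J a)) ≤ 𝔮)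
    (hw : algebraMap R (blowupAlgebra J a) g ∈ 𝔮 * Ideal.span {algebraMap R (blowupAlgebra J a) a}) :
    algebraMap R (blowupAlgebra J a) ϖ ∈ 𝔮 ^ 2 := by
  have h1 : algebraMap R (blowupAlgebra J a) g ∈ 𝔮 ^ 2 := by
    have hle : 𝔮 * Ideal.span {algebraMap R (blowupAlgebra J a) a} ≤ 𝔮 ^ 2 := by
      rw [pow_two]
      exact Ideal.mul_mono_right ((Ideal.span_singleton_le_iff_mem _).mpr (hM (Ideal.mem_map_of_mem _ haM)))
    exact hle hw
  have h2 : algebraMap R (blowupAlgebra J a) (ϖ - g) ∈ 𝔮 ^ 2 := by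
    have hle : (M ^ 2).map (algebraMap R (blowupAlgebra J a)) ≤ 𝔮 ^ 2 := by
      rw [Ideal.map_pow]
      exact Ideal.pow_right_mono hM 2
    exact hle (Ideal.mem_map_of_mem _ h)
  have e : ϖ = g + (ϖ - g) := by ring
  rw [e, map_add]
  exact add_mem h1 h2

/-- The same at a PRIME `𝔓` of `R[J/a]` containing `M · R[J/a]`, on the hyperplane `{g/a = 0}`: `ϖ ∈ 𝔪²` in the local ring `R[J/a]_𝔓`.
OURS. [folklore] -/
theorem algebraMap_localization_mem_sq {J M : Ideal R} {a g ϖ : R} (haM : a ∈ M) (h : ϖ - g ∈ M ^ 2)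
    (𝔓 : Ideal (blowupAlgebra J a)) [𝔓.IsPrime] (hM : M.map (algebraMap R (blowupAlgebra J a)) ≤ 𝔓)
    (hw : algebraMap R (blowupAlgebra J a) g ∈ 𝔓 * Ideal.span {algebraMap R (blowupAlgebra J a) a}) :
    algebraMap (blowupAlgebra J a) (Localization.AtPrime 𝔓) (algebraMap R (blowupAlgebra J a) ϖ) ∈
      (maximalIdeal (Localization.AtPrime 𝔓)) ^ 2 := by
  have hmem := algebraMap_mem_sq haM h 𝔓 hM hw
  rw [← IsLocalization.AtPrime.map_eq_maximalIdeal 𝔓 (Localization.AtPrime 𝔓), ← Ideal.map_pow]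
  exact Ideal.mem_map_of_mem _ hmem

/-- If `𝔮 ⊇ M · R[J/a]` with `M` maximal and `𝔮` proper, then `𝔮` lies over `M`. [folklore] -/
theorem comap_eq_of_map_le {J M : Ideal R} [M.IsMaximal] {a : R} (𝔮 : Ideal (blowupAlgebra J a)) (hq : 𝔮 ≠ ⊤)
    (hM : M.map (algebraMap R (blowupAlgebra J a)) ≤ 𝔮) : 𝔮.comap (algebraMap R (blowupAlgebra J a)) = M := by
  have hle : M ≤ 𝔮.comap (algebraMap R (blowupAlgebra J a)) := by
    rw [← Ideal.map_le_iff_le_comap]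
    exact hM
  exact (Ideal.IsMaximal.eq_of_le inferInstance (fun htop => hq ((Ideal.comap_eq_top_iff).mp htop)) hle).symm

end Ring

/-! ## Scheme level: a BAD-POINT READER for chart primes, and the ribbon corollary -/

section Scheme

variable {X' X : Scheme.{0}} {π : X' ⟶ X} {J : X.IdealSheafData}

set_option maxHeartbeats 1600000 in
/-- **BAD-POINT READER.** For a blowing up `π : X′ → X` along `J`, a base `r : X → Spec O` and `ϖ ∈ O`, generators `c` of `J_s`, an
index `j` and a prime `𝔓` of the chart `𝒪_{X,s}[J_s/c_j]` lying over `𝔪_s` such that the image of the germ `ϖ_s` lies in `𝔓²`: some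
point `x′ ∈ X′` over `s` is BAD — the germ of `ϖ` at `x′` (w.r.t. `π ≫ r`) lies in `𝔪_{x′}²`. OURS. [cite: StacksProject, Tag 0804] -/
theorem exists_point_varpiGerm_mem_sq_of_chart_prime {O : Type} [CommRing O] (r : X ⟶ Spec (.of O)) (ϖ : O)
    (hπ : IsBlowup π J) (s : X) {k : ℕ} (c : Fin k → X.presheaf.stalk s)
    (hc : Ideal.span (Set.range c) = stalkIdeal J s) (j : Fin k)
    (𝔓 : PrimeSpectrum (blowupAlgebra (Ideal.span (Set.range c)) (c j)))
    (h𝔓 : 𝔓.asIdeal.comap (algebraMap _ (blowupAlgebra (Ideal.span (Set.range c)) (c j))) = maximalIdeal (X.presheaf.stalk s))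
    (hbad : algebraMap _ (blowupAlgebra (Ideal.span (Set.range c)) (c j))
        ((X.presheaf.Γgerm s).hom (r.appTop.hom ((Scheme.ΓSpecIso (.of O)).inv.hom ϖ))) ∈ 𝔓.asIdeal ^ 2) :
    ∃ x' : X', π x' = s ∧ (X'.presheaf.Γgerm x').hom ((π ≫ r).appTop.hom ((Scheme.ΓSpecIso (.of O)).inv.hom ϖ)) ∈
      (maximalIdeal (X'.presheaf.stalk x')) ^ 2 := by
  let ε : (CommRingCat.of (chartRing c j) : Type) ≃+* blowupAlgebra (Ideal.span (Set.range c)) (c j) :=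
    reesChartEquiv (I := Ideal.span (Set.range c)) (c j) (Ideal.mem_span_range_self (f := c) (x := j))
  have hε : ∀ a, ε (chartBase c j a) = algebraMap _ (blowupAlgebra (Ideal.span (Set.range c)) (c j)) a :=
    reesChartEquiv_reesChartBase (c j) _
  -- the corresponding prime `𝔴 = ε⁻¹ 𝔓` of the Rees chart, again over `𝔪_s`
  let w : Spec (.of (chartRing c j)) := ⟨𝔓.asIdeal.comap ε, inferInstance⟩
  have hwmem : ∀ b, b ∈ w.asIdeal ↔ ε b ∈ 𝔓.asIdeal := fun b => Iff.rfl
  have hw : w.asIdeal.comap (chartBase c j) = maximalIdeal (X.presheaf.stalk s) := by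
    ext a
    rw [Ideal.mem_comap, hwmem, hε, ← h𝔓, Ideal.mem_comap]
  -- the chart morphism `q : Spec B_j → X′` and the point `x′ = q 𝔴` over `s`
  obtain ⟨q, hiso, hsq⟩ := IsBlowup.exists_chart_morphism_of_index hπ s c hc j
  have hx : π (q w) = s := by
    have h1 : (q ≫ π) w = π (q w) := Scheme.Hom.comp_apply q π w
    rw [← h1, hsq]
    exact ChartPoint.fromSpecStalk_Spec_map_apply_eq (B := CommRingCat.of (chartRing c j)) s (chartBase c j) w hw
  refine ⟨q w, hx, ?_⟩
  haveI := hiso w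
  -- the chart structure map, re-based at the point `π (q 𝔴)` (`= s`) through the specialization isomorphism
  have hsp : s ⤳ π (q w) := specializes_of_eq hx.symm
  let φ : X.presheaf.stalk (π (q w)) ⟶ CommRingCat.of (chartRing c j) :=
    X.presheaf.stalkSpecializes hsp ≫ CommRingCat.ofHom (chartBase c j)
  have hsq' : q ≫ π = Spec.map φ ≫ X.fromSpecStalk (π (q w)) := by
    rw [hsq, Spec.map_comp, Category.assoc, Scheme.SpecMap_stalkSpecializes_fromSpecStalk]
    rfl
  -- (`rw` with the chart identities is too slow here: failed higher-order matches unfold stalk maps; we substitute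
  -- along explicit equations instead, and destructure with `choose` rather than `obtain`)
  have HH := exists_stalk_ringHom_of_chart π (q w) φ q w rfl hsq'
  have hχ := HH.choose_spec.1
  have hloc := HH.choose_spec.2.1
  -- the germ of `ϖ` at `x′` is `π^♯_{x′}(ϖ_{π x′}) = χ (φ ϖ_{π x′})`, and `φ ϖ_{π x′} = chartBase ϖ_s`
  rw [varpiGerm_comp r (π ≫ r) π rfl (q w) ϖ]
  have e2 : φ.hom ((X.presheaf.Γgerm (π (q w))).hom (r.appTop.hom ((Scheme.ΓSpecIso (.of O)).inv.hom ϖ))) =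
      chartBase c j ((X.presheaf.Γgerm s).hom (r.appTop.hom ((Scheme.ΓSpecIso (.of O)).inv.hom ϖ))) := by
    simp only [φ, CommRingCat.hom_comp, RingHom.coe_comp, Function.comp_apply]
    rw [TopCat.Presheaf.Γgerm, TopCat.Presheaf.germ_stalkSpecializes_apply]
    rfl
  -- `𝔴 · 𝒪_{X′,x′} = 𝔪_{x′}` since `𝒪_{X′,x′} = (B_j)_𝔴` via `χ`; hence `θ := χ ∘ ε⁻¹ : 𝒪_{X,s}[J_s/c_j] → 𝒪_{X′,x′}` maps `𝔓` into `𝔪_{x′}`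
  letI := HH.choose.toAlgebra
  haveI hloc' : IsLocalization.AtPrime (X'.presheaf.stalk (q w)) w.asIdeal := hloc
  have hm : w.asIdeal.map HH.choose = maximalIdeal (X'.presheaf.stalk (q w)) := by
    have := IsLocalization.AtPrime.map_eq_maximalIdeal w.asIdeal (X'.presheaf.stalk (q w))
    rwa [RingHom.algebraMap_toAlgebra] at this
  let θ : blowupAlgebra (Ideal.span (Set.range c)) (c j) →+* X'.presheaf.stalk (q w) :=
    HH.choose.comp ε.symm.toRingHom
  have hθ : 𝔓.asIdeal.map θ ≤ maximalIdeal (X'.presheaf.stalk (q w)) := by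
    rw [Ideal.map_le_iff_le_comap]
    intro b hb
    rw [Ideal.mem_comap, ← hm]
    have hb' : ε.symm b ∈ w.asIdeal := by
      rw [hwmem, RingEquiv.apply_symm_apply]
      exact hb
    exact Ideal.mem_map_of_mem HH.choose hb'
  -- `θ (ϖ_s/1) ∈ 𝔪_{x′}²` from `ϖ_s/1 ∈ 𝔓²`, and `θ (ϖ_s/1) = χ (chartBase ϖ_s) = χ (φ ϖ_{π x′}) = π^♯_{x′} ϖ_{π x′}`
  have key : θ (algebraMap _ (blowupAlgebra (Ideal.span (Set.range c)) (c j))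
      ((X.presheaf.Γgerm s).hom (r.appTop.hom ((Scheme.ΓSpecIso (.of O)).inv.hom ϖ)))) ∈
      (maximalIdeal (X'.presheaf.stalk (q w))) ^ 2 := by
    have hle : (𝔓.asIdeal ^ 2).map θ ≤ (maximalIdeal (X'.presheaf.stalk (q w))) ^ 2 := by
      rw [Ideal.map_pow]
      exact Ideal.pow_right_mono hθ 2
    exact hle (Ideal.mem_map_of_mem θ hbad)
  have e3 : θ (algebraMap _ (blowupAlgebra (Ideal.span (Set.range c)) (c j))
      ((X.presheaf.Γgerm s).hom (r.appTop.hom ((Scheme.ΓSpecIso (.of O)).inv.hom ϖ)))) =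
      HH.choose (chartBase c j ((X.presheaf.Γgerm s).hom (r.appTop.hom ((Scheme.ΓSpecIso (.of O)).inv.hom ϖ)))) := by
    show HH.choose (ε.symm (algebraMap _ (blowupAlgebra (Ideal.span (Set.range c)) (c j))
      ((X.presheaf.Γgerm s).hom (r.appTop.hom ((Scheme.ΓSpecIso (.of O)).inv.hom ϖ))))) = _
    rw [← hε, RingEquiv.symm_apply_apply]
  have key2 : HH.choose (chartBase c j ((X.presheaf.Γgerm s).hom (r.appTop.hom ((Scheme.ΓSpecIso (.of O)).inv.hom ϖ)))) ∈
      (maximalIdeal (X'.presheaf.stalk (q w))) ^ 2 :=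
    e3.subst (motive := fun t => t ∈ (maximalIdeal (X'.presheaf.stalk (q w))) ^ 2) key
  have key3 : HH.choose (φ.hom ((X.presheaf.Γgerm (π (q w))).hom (r.appTop.hom ((Scheme.ΓSpecIso (.of O)).inv.hom ϖ)))) ∈
      (maximalIdeal (X'.presheaf.stalk (q w))) ^ 2 :=
    e2.symm.subst (motive := fun t => HH.choose t ∈ (maximalIdeal (X'.presheaf.stalk (q w))) ^ 2) key2
  exact (hχ _).subst (motive := fun t => t ∈ (maximalIdeal (X'.presheaf.stalk (q w))) ^ 2) key3

/-- **K-RIBBON-BAD at scheme level.** After a RIBBON touch at `s` — `ϖ_s − g ∈ 𝔪_s²` for some member `g` of the stalk ideal `J_s = (c)` of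
the centre, `c_j ∈ 𝔪_s` — every prime `𝔓` of the chart `𝒪_{X,s}[J_s/c_j]` containing `𝔪_s` and on the hyperplane `{g/c_j = 0}` of the
exceptional fibre over `s` (def-free: `g ∈ 𝔓 · (c_j)`) yields a BAD point of the blowing up `X′` over `s`: the germ of `ϖ` there lies in `𝔪²`.
(Persistence upward: `…NatBadLocus.not_goodAt_of_bad_below`.) OURS. [folklore] -/
theorem exists_point_bad_of_ribbon {O : Type} [CommRing O] (r : X ⟶ Spec (.of O)) (ϖ : O)
    (hπ : IsBlowup π J) (s : X) {k : ℕ} (c : Fin k → X.presheaf.stalk s)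
    (hc : Ideal.span (Set.range c) = stalkIdeal J s) (j : Fin k) (hcj : c j ∈ maximalIdeal (X.presheaf.stalk s))
    {g : X.presheaf.stalk s}
    (hrib : (X.presheaf.Γgerm s).hom (r.appTop.hom ((Scheme.ΓSpecIso (.of O)).inv.hom ϖ)) - g ∈
      (maximalIdeal (X.presheaf.stalk s)) ^ 2)
    (𝔓 : PrimeSpectrum (blowupAlgebra (Ideal.span (Set.range c)) (c j)))
    (hM : (maximalIdeal (X.presheaf.stalk s)).map (algebraMap _ (blowupAlgebra (Ideal.span (Set.range c)) (c j))) ≤ 𝔓.asIdeal)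
    (hw : algebraMap _ (blowupAlgebra (Ideal.span (Set.range c)) (c j)) g ∈
      𝔓.asIdeal * Ideal.span {algebraMap _ (blowupAlgebra (Ideal.span (Set.range c)) (c j)) (c j)}) :
    ∃ x' : X', π x' = s ∧ (X'.presheaf.Γgerm x').hom ((π ≫ r).appTop.hom ((Scheme.ΓSpecIso (.of O)).inv.hom ϖ)) ∈
      (maximalIdeal (X'.presheaf.stalk x')) ^ 2 :=
  exists_point_varpiGerm_mem_sq_of_chart_prime r ϖ hπ s c hc j 𝔓
    (comap_eq_of_map_le 𝔓.asIdeal 𝔓.isPrime.ne_top hM) (algebraMap_mem_sq hcj hrib 𝔓.asIdeal hM hw)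

/-- **Consequence in the `GoodAt` currency** (`Split.GoodAt` of `…EquisingularLiftDefs`, via `…NatBadLocus`): with `ϖ` irreducible,
EVERY point `x″` of any later stage `P″ → X′` over the bad point `x′` of `exists_point_bad_of_ribbon` is not good. OURS. [folklore] -/
theorem not_goodAt_over_ribbon_line {O : Type} [CommRing O] (r : X ⟶ Spec (.of O)) (ϖ : O) (hϖ : Irreducible ϖ)
    (hπ : IsBlowup π J) (s : X) {k : ℕ} (c : Fin k → X.presheaf.stalk s)
    (hc : Ideal.span (Set.range c) = stalkIdeal J s) (j : Fin k) (hcj : c j ∈ maximalIdeal (X.presheaf.stalk s))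
    {g : X.presheaf.stalk s}
    (hrib : (X.presheaf.Γgerm s).hom (r.appTop.hom ((Scheme.ΓSpecIso (.of O)).inv.hom ϖ)) - g ∈
      (maximalIdeal (X.presheaf.stalk s)) ^ 2)
    (𝔓 : PrimeSpectrum (blowupAlgebra (Ideal.span (Set.range c)) (c j)))
    (hM : (maximalIdeal (X.presheaf.stalk s)).map (algebraMap _ (blowupAlgebra (Ideal.span (Set.range c)) (c j))) ≤ 𝔓.asIdeal)
    (hw : algebraMap _ (blowupAlgebra (Ideal.span (Set.range c)) (c j)) g ∈
      𝔓.asIdeal * Ideal.span {algebraMap _ (blowupAlgebra (Ideal.span (Set.range c)) (c j)) (c j)}) :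
    ∃ x' : X', π x' = s ∧ ∀ (P'' : Scheme.{0}) (f : P'' ⟶ X') (r'' : P'' ⟶ Spec (.of O)), f ≫ (π ≫ r) = r'' →
      ∀ y'' : P'', f y'' = x' → ¬ Summit.ResolutionOfSingularities.ResolutionOfSingularities.Theses.EquisingularLift.Split.GoodAt r'' y'' := by
  obtain ⟨x', hx, hbad⟩ := exists_point_bad_of_ribbon r ϖ hπ s c hc j hcj hrib 𝔓 hM hw
  refine ⟨x', hx, fun P'' f r'' hf y'' hy => ?_⟩
  subst hy
  exact not_goodAt_of_bad_below (π ≫ r) r'' f hf y'' ϖ hϖ hbad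

end Scheme

end RibbonBad

end Summit.ResolutionOfSingularities.ResolutionOfSingularities.Cruxes.EquisingularLiftNat.Sections
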